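import Summits.QuantumFields.YangMills.Theorems.SwapVirialDeficitNearFlatEnd
import Summits.QuantumFields.YangMills.Theorems.SwapVirialDeficitNearFlatRelations
import HarnessLib

/-!
# THE GLOBAL NEAR-FLAT PROJECTION: every leader configuration is within `176·L³·F̂^{1/6}` of an EXACTLY FLAT one
# (free-hands support of ⟨stmt-QuantumFields-24197⟩ `SwapVirialDeficit.SwapGluedStiffness`; LEAD g98's plan of record memo7 §C(c) «near-flat projection lemma, Hölder
# suffices» — the last line: the case glue over ✓`exists_flat_near_of_heavy_triple` (w3 g66 ∘ LEAD g99) and the light-triple corner (LEAD g99 ✓`exists_flat_corner_general`))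

For a chart point `q = (C, U)` with principal deficit `F = chartDeficit L 0 1 q`, ✓`relations_le_of_chartDeficit` bounds every relation by `m = 60L³√F/√2 ≤ 43L³√F`.
Put `r = F^{1/6}` (so `√F = r³`).  HEAVY TRIPLE (some `‖im Ĉ_μ‖ > r`, `μ ∈ {0,1,2}`): ✓`exists_flat_near_of_heavy_triple` with `κ = m`, `ε = 15L³r`
(`3(m + 2m/r)² ≤ 3·(129L³r²)² = 49923L⁶r⁴ ≤ (15L³r)⁴`) moves every leader by `≤ m/r + 4ε ≤ 103L³r`.  LIGHT TRIPLE (all `‖im Ĉ_μ‖ ≤ r`, hub arbitrary): the corner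
✓`exists_flat_corner_general` with `ε = r + m` moves by `≤ 4(r + m) ≤ 176L³r`.
* §1 ★ `exists_flat_near_corner_general_chart` — the light-triple corner in the leader chart (bridge ✓`flat_of_sigma_relations`; the hub is NOT assumed light, unlike
  ✓`exists_flat_near_corner`);
* §2 ★★★ `exists_flat_near (q) (hF : F ≤ 1) : ∃ qf, chartDeficit L 0 1 qf = 0 ∧ (∀ i, qf.2 i = 1) ∧ ∀ k, ‖Ĉ_k − su2Quat (qf.1 k)‖ ≤ 176·L³·F^{1/6}`.
The followers of `q` are within `48L³√F/√2` of `1 = qf.2` by ✓`relations_le_of_chartDeficit` (not restated).  Sharper LOCAL versions: bulk hubs Lipschitz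
(✓`exists_flat_near_bulk`), B-tubes Lipschitz (✓`exists_stratumB_near_of_coax_tube`); the exponent `1/6` is only needed to be positive (matching on ω-patches, memo7 §C(c)).

HONEST LABEL: assembly of landed lemmas; stubs B ∕ core ∕ 001 of skeleton ➎, ⟨24197⟩ ∕ ⟨24194⟩ ∕ ⟨24497⟩ OPEN; own crux ⟨22884⟩ `LargeFieldMassRefinementTail` OPEN
(blocked-on ⟨19935⟩); the Yang–Mills mass gap is NOT proved; no summit is proved by a line.  THEOREMS ONLY (0 `def`, 0 `sorry`), standard axioms.
LEAD seat ym-line-sfw-p2 g99 (cell ym-idea-1, free hands), `--supports stmt-QuantumFields-24197`.  References: [cite: Luscher1983, §2]; [folklore].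
-/

set_option autoImplicit false

noncomputable section

open Quaternion
open scoped Quaternion RealInnerProductSpace
open Literature.MathematicalPhysics.QuantumFieldTheory hiding SU2
open Literature.MathematicalPhysics.QuantumLattice
open Literature.Analysis.Calculus (radialUnit radialUnit_def)
open Summit.QuantumFields.YangMills.Theorems.SwapVirialDeficit.ZeroModeSigma (su2Quat_quatToSU2_eq_radialUnit)

namespace Summit.QuantumFields.YangMills.Theorems.SwapVirialDeficit.NearFlat

open Summit.QuantumFields.YangMills.Theorems.FemtoTransferGap
open Summit.QuantumFields.YangMills.Theorems.FemtoTransferGap.TT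
open Summit.QuantumFields.YangMills.Theorems.VirialFluxGap.RingDeficit
open Summit.QuantumFields.YangMills.Theorems.SwapVirialDeficit.SwapRing
open Summit.QuantumFields.YangMills.Theorems.SwapVirialDeficit.BlowUpRing

variable {L : ℕ} [NeZero L]

/-! ## §1 The light-triple corner in the leader chart -/

/-- ★ **THE LIGHT-TRIPLE CORNER IN THE LEADER CHART** (hub arbitrary): `‖im Ĉ₀‖, ‖im Ĉ₂‖ ≤ ε` and one σ-residual `‖ĉĈ₁ − Ĉ₀ĉ‖ ≤ ε` ⟹ an exactly flat chart point
(central leaders `σ₀, σ₀, σ₂`, the same hub, followers `1`) with every leader moved by `≤ 4ε`. [cite: Luscher1983, §2] -/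
theorem exists_flat_near_corner_general_chart (q : (Fin 4 → SU2) × (Fol L → SU2)) {ε : ℝ} (hε : 0 ≤ ε)
    (h0 : ‖(su2Quat (q.1 0)).im‖ ≤ ε) (h2 : ‖(su2Quat (q.1 2)).im‖ ≤ ε)
    (hw : ‖su2Quat (q.1 3) * su2Quat (q.1 1) - su2Quat (q.1 0) * su2Quat (q.1 3)‖ ≤ ε) :
    ∃ qf : (Fin 4 → SU2) × (Fol L → SU2), chartDeficit L (fun _ => false) (fun _ => 1) qf = 0 ∧ (∀ i, qf.2 i = 1) ∧
      ∀ k, ‖su2Quat (q.1 k) - su2Quat (qf.1 k)‖ ≤ 4 * ε := by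
  obtain ⟨c', C₀', C₁', C₂', hc', hC₀', hC₁', hC₂', h01, h02, h12, hs0, hs1, hs2, hdc, hd0, hd1, hd2⟩ :=
    exists_flat_corner_general (norm_su2Quat (q.1 3)) (norm_su2Quat (q.1 0)) (norm_su2Quat (q.1 2)) hε h0 h2 hw
  set Cf : Fin 4 → ℍ := ![C₀', C₁', C₂', c'] with hCf
  have hfu : ∀ k, ‖Cf k‖ = 1 := fun k => by fin_cases k <;> simp [hCf, hc', hC₀', hC₁', hC₂']
  have hcomm : ∀ μ ν : Fin 3, Cf (Fin.castSucc μ) * Cf (Fin.castSucc ν) = Cf (Fin.castSucc ν) * Cf (Fin.castSucc μ) := by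
    intro μ ν
    fin_cases μ <;> fin_cases ν
    all_goals simp [hCf]
    all_goals first | exact h01 | exact h02 | exact h12 | exact h01.symm | exact h02.symm | exact h12.symm
  have hflat := flat_of_sigma_relations (L := L) Cf hfu hcomm (by simp [hCf]; exact hs0) (by simp [hCf]; exact hs1) (by simp [hCf]; exact hs2)
  have hread : ∀ k, su2Quat (quatToSU2 (Cf k)) = Cf k := fun k => by
    have hne : Cf k ≠ 0 := by intro h0'; have := hfu k; rw [h0', norm_zero] at this; exact zero_ne_one this
    rw [su2Quat_quatToSU2_eq_radialUnit hne, radialUnit_def, hfu k, inv_one, one_smul]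
  refine ⟨(fun k => quatToSU2 (Cf k), fun _ => 1), hflat, fun _ => rfl, fun k => ?_⟩
  show ‖su2Quat (q.1 k) - su2Quat (quatToSU2 (Cf k))‖ ≤ 4 * ε
  rw [hread]
  fin_cases k
  · simpa [hCf] using hd0
  · simpa [hCf] using hd1
  · simpa [hCf] using hd2
  · simpa [hCf] using hdc

/-! ## §2 The global projection -/

/-- `60/√2 ≤ 43`. [folklore] -/
theorem sixty_div_sqrt_two_le : (60 : ℝ) / Real.sqrt 2 ≤ 43 := by
  have hs : (0 : ℝ) < Real.sqrt 2 := by positivity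
  rw [div_le_iff₀ hs]
  have h2 : Real.sqrt 2 ^ 2 = 2 := Real.sq_sqrt (by norm_num)
  nlinarith [Real.sqrt_nonneg 2]

/-- ★★★ **THE GLOBAL NEAR-FLAT PROJECTION**: for every chart point `q` with principal deficit `F = F̂(q) ≤ 1` there is an EXACTLY FLAT `qf` (`F̂(qf) = 0`,
followers `1`) with `‖Ĉ_k − Ĉf_k‖ ≤ 176·L³·F^{1/6}` for all four leaders. [cite: Luscher1983, §2] -/
theorem exists_flat_near (q : (Fin 4 → SU2) × (Fol L → SU2)) (hF : chartDeficit L (fun _ => false) (fun _ => 1) q ≤ 1) :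
    ∃ qf : (Fin 4 → SU2) × (Fol L → SU2), chartDeficit L (fun _ => false) (fun _ => 1) qf = 0 ∧ (∀ i, qf.2 i = 1) ∧
      ∀ k, ‖su2Quat (q.1 k) - su2Quat (qf.1 k)‖ ≤ 176 * (L : ℝ) ^ 3 * (chartDeficit L (fun _ => false) (fun _ => 1) q) ^ (1 / 6 : ℝ) := by
  obtain ⟨hc, hσ, -⟩ := relations_le_of_chartDeficit (L := L) q
  obtain ⟨F, hFdef⟩ : ∃ F : ℝ, chartDeficit L (fun _ => false) (fun _ => 1) q = F := ⟨_, rfl⟩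
  have hF0 : 0 ≤ F := by rw [← hFdef]; exact chartDeficit_nonneg _ _ q
  rw [hFdef] at hc hσ hF ⊢
  have hL1 : (1 : ℝ) ≤ L := by exact_mod_cast Nat.one_le_iff_ne_zero.mpr (NeZero.ne L)
  have hL3 : (1 : ℝ) ≤ (L : ℝ) ^ 3 := one_le_pow₀ hL1
  -- `F = 0`: `q` is flat already
  rcases hF0.eq_or_lt with hFz | hFpos
  · have hq0 : chartDeficit L (fun _ => false) (fun _ => 1) q = 0 := by rw [hFdef, ← hFz]
    refine ⟨q, hq0, fun i => ((chartDeficit_eq_zero_iff (L := L) q).1 hq0).2.2 i, fun k => ?_⟩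
    rw [sub_self, norm_zero]; positivity
  -- the letters `m = 60L³√F/√2 ≤ 43L³r³`, `r = F^{1/6} ∈ (0, 1]`
  set r : ℝ := F ^ (1 / 6 : ℝ) with hr
  have hr0 : 0 < r := Real.rpow_pos_of_pos hFpos _
  have hr1 : r ≤ 1 := Real.rpow_le_one hF0 hF (by norm_num)
  have hr3 : Real.sqrt F = r ^ 3 := by
    rw [hr, ← Real.rpow_natCast, ← Real.rpow_mul hF0, Real.sqrt_eq_rpow]; norm_num
  obtain ⟨m, hm⟩ : ∃ m : ℝ, 60 * (L : ℝ) ^ 3 * Real.sqrt F / Real.sqrt 2 = m := ⟨_, rfl⟩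
  rw [hm] at hc hσ
  have hm0 : 0 ≤ m := by rw [← hm]; positivity
  have hm43 : m ≤ 43 * (L : ℝ) ^ 3 * r ^ 3 := by
    rw [← hm, hr3]
    have h60 := sixty_div_sqrt_two_le
    have hx : 0 ≤ (L : ℝ) ^ 3 * r ^ 3 := by positivity
    calc 60 * (L : ℝ) ^ 3 * r ^ 3 / Real.sqrt 2 = (60 / Real.sqrt 2) * ((L : ℝ) ^ 3 * r ^ 3) := by ring
      _ ≤ 43 * ((L : ℝ) ^ 3 * r ^ 3) := mul_le_mul_of_nonneg_right h60 hx
      _ = 43 * (L : ℝ) ^ 3 * r ^ 3 := by ring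
  have hr31 : r ^ 3 ≤ r := by nlinarith [pow_le_one₀ hr0.le hr1 (n := 2)]
  have hr21 : r ^ 2 ≤ r := by nlinarith
  -- the σ-residuals in the shape of `exists_flat_near_of_heavy_triple`
  rw [show (Fin.last 3 : Fin 4) = 3 from rfl] at hσ
  have hσ0 : ‖su2Quat (q.1 3) * su2Quat (q.1 1) - su2Quat (q.1 0) * su2Quat (q.1 3)‖ ≤ m := by
    have h := hσ 0; rw [Equiv.swap_apply_left] at h; exact h
  have hσ1 : ‖su2Quat (q.1 3) * su2Quat (q.1 0) - su2Quat (q.1 1) * su2Quat (q.1 3)‖ ≤ m := by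
    have h := hσ 1; rw [Equiv.swap_apply_right] at h; exact h
  have hσ2 : ‖su2Quat (q.1 3) * su2Quat (q.1 2) - su2Quat (q.1 2) * su2Quat (q.1 3)‖ ≤ m := by
    have h := hσ 2; rw [Equiv.swap_apply_of_ne_of_ne (by decide) (by decide)] at h; exact h
  by_cases hheavy : ∃ h : Fin 3, r < ‖(su2Quat (q.1 (Fin.castSucc h))).im‖
  · -- HEAVY TRIPLE
    obtain ⟨h, hh⟩ := hheavy
    have hN0 : 0 < ‖(su2Quat (q.1 (Fin.castSucc h))).im‖ := hr0.trans hh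
    have hhne : (su2Quat (q.1 (Fin.castSucc h))).im ≠ 0 := norm_pos_iff.1 hN0
    -- `m/‖im‖ ≤ m/r ≤ 43L³r²`
    have hD : m / ‖(su2Quat (q.1 (Fin.castSucc h))).im‖ ≤ 43 * (L : ℝ) ^ 3 * r ^ 2 := by
      calc m / ‖(su2Quat (q.1 (Fin.castSucc h))).im‖ ≤ m / r := div_le_div_of_nonneg_left hm0 hr0 hh.le
        _ ≤ 43 * (L : ℝ) ^ 3 * r ^ 3 / r := div_le_div_of_nonneg_right hm43 hr0.le
        _ = 43 * (L : ℝ) ^ 3 * r ^ 2 := by rw [div_eq_iff hr0.ne']; ring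
    have hε0 : 0 ≤ 15 * (L : ℝ) ^ 3 * r := by positivity
    have hεW : 3 * (m + 2 * (m / ‖(su2Quat (q.1 (Fin.castSucc h))).im‖)) ^ 2 ≤ (15 * (L : ℝ) ^ 3 * r) ^ 4 := by
      have h1 : m + 2 * (m / ‖(su2Quat (q.1 (Fin.castSucc h))).im‖) ≤ 129 * (L : ℝ) ^ 3 * r ^ 2 := by nlinarith
      have h2 : 0 ≤ m + 2 * (m / ‖(su2Quat (q.1 (Fin.castSucc h))).im‖) := by positivity
      have h3 : (m + 2 * (m / ‖(su2Quat (q.1 (Fin.castSucc h))).im‖)) ^ 2 ≤ (129 * (L : ℝ) ^ 3 * r ^ 2) ^ 2 := pow_le_pow_left₀ h2 h1 2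
      have hL6 : (L : ℝ) ^ 6 ≤ (L : ℝ) ^ 12 := pow_le_pow_right₀ hL1 (by norm_num)
      nlinarith [pow_nonneg hr0.le 4, pow_nonneg (zero_le_one.trans hL1) 6]
    obtain ⟨qf, hflat, hfol, hdμ, hd3⟩ :=
      exists_flat_near_of_heavy_triple (L := L) q h hhne hε0 hσ0 hσ1 hσ2 (fun μ => hc h μ) hεW
    refine ⟨qf, hflat, hfol, fun k => ?_⟩
    have hbound : m / ‖(su2Quat (q.1 (Fin.castSucc h))).im‖ + 4 * (15 * (L : ℝ) ^ 3 * r) ≤ 176 * (L : ℝ) ^ 3 * r := by nlinarith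
    have hbound3 : 4 * (15 * (L : ℝ) ^ 3 * r) ≤ 176 * (L : ℝ) ^ 3 * r := by nlinarith
    fin_cases k
    · exact (hdμ 0).trans hbound
    · exact (hdμ 1).trans hbound
    · exact (hdμ 2).trans hbound
    · exact hd3.trans hbound3
  · -- LIGHT TRIPLE: the corner with `ε = r + m`
    simp only [not_exists, not_lt] at hheavy
    have hl0 : ‖(su2Quat (q.1 0)).im‖ ≤ r + m := (hheavy 0).trans (by linarith)
    have hl2 : ‖(su2Quat (q.1 2)).im‖ ≤ r + m := (hheavy 2).trans (by linarith)
    have hw : ‖su2Quat (q.1 3) * su2Quat (q.1 1) - su2Quat (q.1 0) * su2Quat (q.1 3)‖ ≤ r + m := hσ0.trans (by linarith)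
    obtain ⟨qf, hflat, hfol, hd⟩ := exists_flat_near_corner_general_chart (L := L) q (by positivity) hl0 hl2 hw
    refine ⟨qf, hflat, hfol, fun k => (hd k).trans ?_⟩
    nlinarith

end Summit.QuantumFields.YangMills.Theorems.SwapVirialDeficit.NearFlat

end
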